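import Summits.QuantumFields.BalabanUV.T4Continuum.Spine.NE9.MemoryFromRate

/-!
# T⁴ programme, spine estimate NE9 (node U3, history side) — WHERE CLAUSE N2 WENT: for a MARKOV step the tower η-rate (tower-NE5) and the
# E-side fading memory are ONE AND THE SAME contraction; row C24's «N2 idle GIVEN tower-NE5» RELOCATES the smallness clause into NE5's
# proof obligations, it does not discharge it — census item of cell `pub-balaban-gaps`, seat ne9 (gen 4), row C28 (honesty check on C24)

Cell `pub-balaban-gaps` (YM blitz G2, seat ne9, unit `pub-balaban-gaps-ne9-g4`; record `run/shared/lean/pub/pub-balaban-gaps/ne/NE9.md` §5 row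
C28).  Gen 3's row C24 (`MemoryFromRate`) showed: GIVEN tower-NE5, node U3 → U6 needs NO decay of NE9's moduli and NO clause N2
(`ω + c < 1`, the Schur contractivity of Bałaban's old-term channel, row C22), and carried the honesty clause «tower-NE5's `∀ b`
quantification is WHERE one-step UV-insensitivity enters; C24 iterates it, it does not produce fading from nothing».  This file makes that
clause QUANTITATIVE on the simplest Markov model of the recursion SHAPE of `T4HistoryLipschitzRecursion` — the LINEAR RENEWAL TOWER
`F m g = Σ_{i<m} a^{m−1−i}·φ(g_i)` (`linTower a φ`; state `x_{m+1} = a·x_m + φ(g_m)`: the step re-injects the old activity with weight `a`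
= the channel's one-step weight, and creates `φ(g_m)` from the last coupling):
* `linTower_succ`: the Markov recursion; `towerDiff_eq`: the tower difference is EXACTLY `F (m+1) g − F m (g ∘ succ) = a^m·φ(g_0)` — one
  extra UV step perturbs the INITIAL state by `φ(g_0)` and the perturbation is transported with weight `a` per scale;
* `towerRate_of_lt_one`: `0 ≤ a < 1` and `|φ| ≤ C` on the admissible first couplings ⇒ tower-NE5's shape with `θ = a`, `C₅ = C`;
  `not_towerRate_of_one_le`: `a ≥ 1` and ONE admissible `b` with `φ(b) ≠ 0` ⇒ NO tower rate `C₅θ^m` with `θ < 1` on any window containing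
  the constant history `b` — tower-NE5 FAILS exactly when the channel does not contract;
* `moduli_linTower`: the natural NE9 moduli are `Λ m i = ℓ·a^{m−1−i}` (`φ` `ℓ`-Lipschitz): `T4OutputRate.FadingMemory` iff `a < 1`
  (`fadingMemory_moduli_of_lt_one`, `not_fadingMemory_moduli_of_one_le`) — the SAME dichotomy;
* `towerRate_iff_lt_one`: on `T4OutputRate.Window γ`, for `0 ≤ a`, `φ` bounded on `]0, γ]` and not vanishing at some admissible `b`:
  (∃ `C₅`, `θ < 1`, tower rate) ⟺ `a < 1` ⟺ (the natural moduli have `FadingMemory` at some `ω < 1`, given `ℓ > 0`).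
VERDICT FOR THE ROW (C28): for a Markov step the contraction appears ONCE, in three typed guises — E-side fading (row C3,
`ne9_and_fadingMemory_of_geometricStep`'s `hsmall`), Schur contractivity of the channel (row C22, `schur_lt_one_iff`), and the tower η-rate
`θ < 1` (row C24's hypothesis `hT`).  So C24 is RIGHT AS BOOKKEEPING (the spine assumes NE5 for every consecutive pair of run lengths anyway,
hence owes no separate N2 at node U3 → U6) and must NOT be read as a discharge: a PROOF of tower-NE5 for Bałaban's step pays the channel's
contraction — clause N2 belongs to NE5's obligations (cell row NE5, node O∕W1), where the η-rate `θ` must dominate the channel weight.  For the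
lead's table: «N2: idle at U3 → U6 given tower-NE5; RELOCATED into NE5 (same scalar), not deleted».  Classification UNCHANGED (WORK-bound, W1).

HONEST FRAMING: a linear toy of the recursion SHAPE (real analysis); nothing of Bałaban's step is modelled or asserted; tower-NE5 and NE9
NOT PRINTED ∕ NOT PROVED; spine PROVED 0∕9 unchanged; NOT UV stability, NOT the continuum limit, NOT infinite volume, NOT a mass gap, NOT
Clay.  HONEST DEPENDENCY: continuum YM on T⁴ ⇐ BetaPertH ∧ nine spine estimates (0∕9 proved); BetaPertH ⇐ (D1) ∧ (D4) ∧ CAP+tail.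

References (TYPES only): [Balaban1987RG1] = T. Bałaban, Commun. Math. Phys. **109** (1987) 249–301, p. 256 (*"E_k … is a sum of
contributions coming from the k successive integrations"*), Thm 1 p. 259, p. 298.
-/

namespace Summit.QuantumFields.BalabanUV.T4Continuum.NE9.TowerRateRelocation

open scoped BigOperators
open Finset Filter Topology
open Literature.MathematicalPhysics.QuantumFieldTheory.Balaban1983to89
open Literature.MathematicalPhysics.QuantumFieldTheory.Balaban1983to89.T4OutputRate

/-! ## §1 The linear renewal tower and its Markov recursion -/

/-- The LINEAR RENEWAL TOWER `F m g = Σ_{i<m} a^{m−1−i}·φ(g_i)`: the scale-`m` term of the Markov recursion `x_{m+1} = a·x_m + φ(g_m)`,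
`x_0 = 0` — channel weight `a` per scale, creation `φ` from the last coupling (the SHAPE of `T4HistoryLipschitzRecursion`'s step, linearised;
nothing of Bałaban's). [folklore] -/
noncomputable def linTower (a : ℝ) (φ : ℝ → ℝ) (m : ℕ) (g : ℕ → ℝ) : ℝ :=
  ∑ i ∈ range m, a ^ (m - 1 - i) * φ (g i)

variable {a : ℝ} {φ : ℝ → ℝ}

/-- No term at scale `0`. [folklore] -/
theorem linTower_zero (g : ℕ → ℝ) : linTower a φ 0 g = 0 := by
  simp [linTower]

/-- **THE MARKOV RECURSION** `F (m+1) g = a·F m g + φ(g_m)`. [folklore] -/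
theorem linTower_succ (m : ℕ) (g : ℕ → ℝ) : linTower a φ (m + 1) g = a * linTower a φ m g + φ (g m) := by
  unfold linTower
  rw [sum_range_succ, mul_sum, show m + 1 - 1 - m = 0 by omega, pow_zero, one_mul]
  congr 1
  refine sum_congr rfl fun i hi => ?_
  rw [mem_range] at hi
  rw [← mul_assoc, ← pow_succ', show m - 1 - i + 1 = m + 1 - 1 - i by omega]

/-- **THE TOWER DIFFERENCE IS EXACT**: `F (m+1) g − F m (g ∘ succ) = a^m·φ(g_0)` — prepending one bare coupling perturbs the initial state by
`φ(g_0)`, transported with weight `a` per scale. [folklore] -/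
theorem towerDiff_eq (m : ℕ) (g : ℕ → ℝ) :
    linTower a φ (m + 1) g - linTower a φ m (fun i => g (i + 1)) = a ^ m * φ (g 0) := by
  induction m with
  | zero => simp [linTower_succ, linTower_zero]
  | succ m ih =>
    rw [linTower_succ (m + 1) g, linTower_succ m (fun i => g (i + 1)), pow_succ]
    linear_combination a * ih

/-! ## §2 Tower-NE5 holds iff the channel contracts -/

/-- **CONTRACTING CHANNEL ⇒ TOWER-NE5's SHAPE**: `0 ≤ a < 1` and `|φ(b)| ≤ C` for the admissible first couplings `b ∈ S` ⇒
`|F (m+1) g − F m (g ∘ succ)| ≤ C·a^m` for every history with `g_0 ∈ S` (rate `θ = a`). [folklore] -/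
theorem towerRate_of_lt_one {C : ℝ} {S : Set ℝ} (ha0 : 0 ≤ a) (hφ : ∀ b ∈ S, |φ b| ≤ C)
    (m : ℕ) {g : ℕ → ℝ} (hg : g 0 ∈ S) :
    |linTower a φ (m + 1) g - linTower a φ m (fun i => g (i + 1))| ≤ C * a ^ m := by
  rw [towerDiff_eq, abs_mul, abs_of_nonneg (pow_nonneg ha0 m), mul_comm]
  exact mul_le_mul_of_nonneg_right (hφ _ hg) (pow_nonneg ha0 m)

/-- **NON-CONTRACTING CHANNEL ⇒ NO TOWER RATE**: `1 ≤ a` and one admissible `b` with `φ(b) ≠ 0` whose constant history lies in `W` ⇒ there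
are NO `C₅` and `θ < 1` with `|F (m+1) g − F m (g ∘ succ)| ≤ C₅θ^m` for all `m` and all `g ∈ W` (along `g ≡ b` the difference is
`a^m·φ(b)`, of modulus `≥ |φ(b)| > 0`). [folklore] -/
theorem not_towerRate_of_one_le {W : Set (ℕ → ℝ)} {b : ℝ} (ha : 1 ≤ a) (hb : φ b ≠ 0) (hW : (fun _ : ℕ => b) ∈ W) :
    ¬ ∃ C₅ θ : ℝ, 0 ≤ θ ∧ θ < 1 ∧
      ∀ m, ∀ g ∈ W, |linTower a φ (m + 1) g - linTower a φ m (fun i => g (i + 1))| ≤ C₅ * θ ^ m := by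
  rintro ⟨C₅, θ, hθ0, hθ1, hT⟩
  have hφ : 0 < |φ b| := abs_pos.mpr hb
  -- C₅ θ^m → 0, so eventually C₅ θ^m < |φ b|
  have ht : Tendsto (fun m : ℕ => C₅ * θ ^ m) atTop (𝓝 0) := by
    simpa using (tendsto_pow_atTop_nhds_zero_of_lt_one hθ0 hθ1).const_mul C₅
  obtain ⟨m, hm⟩ := (ht.eventually (gt_mem_nhds hφ)).exists
  have h := hT m (fun _ => b) hW
  rw [towerDiff_eq, abs_mul] at h
  have hlow : |φ b| ≤ |a ^ m| * |φ b| := by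
    have h1 : 1 ≤ |a ^ m| := by
      rw [abs_of_nonneg (pow_nonneg (by linarith) m)]
      exact one_le_pow₀ ha
    nlinarith
  linarith

/-! ## §3 The natural NE9 moduli: fading iff the channel contracts — the same dichotomy -/

/-- **THE NATURAL MODULI**: `φ` `ℓ`-Lipschitz ⇒ `|F m g − F m g'| ≤ Σ_{i<m} (ℓ·|a|^{m−1−i})·|g_i − g'_i|` — `T4OutputRate.NE9`'s shape (decay
stripped) with `Λ m i = ℓ·|a|^{m−1−i}`: GROWING for `|a| > 1`, constant for `|a| = 1`, FADING for `|a| < 1`. [folklore] -/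
theorem moduli_linTower {ℓ : ℝ} (hφ : ∀ x y, |φ x - φ y| ≤ ℓ * |x - y|) (m : ℕ) (g g' : ℕ → ℝ) :
    |linTower a φ m g - linTower a φ m g'| ≤ ∑ i ∈ range m, ℓ * |a| ^ (m - 1 - i) * |g i - g' i| := by
  unfold linTower
  rw [← sum_sub_distrib]
  refine (abs_sum_le_sum_abs _ _).trans (sum_le_sum fun i _ => ?_)
  rw [← mul_sub, abs_mul, abs_pow]
  calc |a| ^ (m - 1 - i) * |φ (g i) - φ (g' i)| ≤ |a| ^ (m - 1 - i) * (ℓ * |g i - g' i|) :=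
        mul_le_mul_of_nonneg_left (hφ _ _) (pow_nonneg (abs_nonneg a) _)
    _ = ℓ * |a| ^ (m - 1 - i) * |g i - g' i| := by ring

/-- **CONTRACTING CHANNEL ⇒ FADING MODULI**: `0 < a < 1`, `0 ≤ ℓ` ⇒ `T4OutputRate.FadingMemory (ℓ∕a) a (fun m i ↦ ℓ·|a|^{m−1−i})`.
[folklore] -/
theorem fadingMemory_moduli_of_lt_one {ℓ : ℝ} (ha0 : 0 < a) (ha1 : a < 1) (hℓ : 0 ≤ ℓ) :
    FadingMemory (ℓ / a) a (fun m i => ℓ * |a| ^ (m - 1 - i)) := by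
  intro k i hik
  show 0 ≤ ℓ * |a| ^ (k - 1 - i) ∧ ℓ * |a| ^ (k - 1 - i) ≤ ℓ / a * a ^ (k - i)
  rw [abs_of_pos ha0]
  refine ⟨by positivity, ?_⟩
  rw [div_mul_eq_mul_div, le_div_iff₀ ha0]
  rcases Nat.lt_or_ge i k with h | h
  · rw [show k - i = k - 1 - i + 1 by omega, pow_succ]
    exact le_of_eq (by ring)
  · have hk : k - 1 - i = 0 := by omega
    have hk' : k - i = 0 := by omega
    rw [hk, hk', pow_zero, mul_one]
    nlinarith

/-- **NON-CONTRACTING CHANNEL ⇒ NO FADING**: `1 ≤ a`, `0 < ℓ` ⇒ the natural moduli are NOT `T4OutputRate.FadingMemory C₉ ω` for ANY `C₉` and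
ANY `0 ≤ ω < 1` (column `i = 0`: `ℓ·a^{m−1} ≥ ℓ` against `C₉ω^m → 0`) — the arithmetic of `T4HistoryLipschitzRecursion.sticky_not_fadingMemory`.
[folklore] -/
theorem not_fadingMemory_moduli_of_one_le {ℓ : ℝ} (ha : 1 ≤ a) (hℓ : 0 < ℓ) {C₉ ω : ℝ} (hω0 : 0 ≤ ω) (hω1 : ω < 1) :
    ¬ FadingMemory C₉ ω (fun m i => ℓ * |a| ^ (m - 1 - i)) := by
  intro hF
  have ht : Tendsto (fun m : ℕ => C₉ * ω ^ m) atTop (𝓝 0) := by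
    simpa using (tendsto_pow_atTop_nhds_zero_of_lt_one hω0 hω1).const_mul C₉
  obtain ⟨m, hm⟩ := (ht.eventually (gt_mem_nhds hℓ)).exists
  have h := (hF m 0 (Nat.zero_le m)).2
  simp only [Nat.sub_zero] at h
  have hlow : ℓ ≤ ℓ * |a| ^ (m - 1) := by
    have h1 : 1 ≤ |a| ^ (m - 1) := one_le_pow₀ (by rw [abs_of_nonneg (by linarith)]; exact ha)
    nlinarith
  linarith

/-! ## §4 The dichotomy in one statement -/

/-- **TOWER-NE5 ⟺ CONTRACTION ⟺ FADING (linear Markov tower).**  On `T4OutputRate.Window γ`, for a channel weight `a ≥ 0` and a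
creation function `φ` bounded on `]0, γ]`, `ℓ`-Lipschitz with `ℓ > 0`, and not vanishing at some admissible `b`:
(i) (∃ `C₅`, `0 ≤ θ < 1`: tower rate `C₅θ^m` on the window) ⟺ `a < 1`; (ii) `a < 1` ⟺ (∃ `C₉`, `0 ≤ ω < 1`: the natural moduli
`ℓ·|a|^{m−1−i}` have `FadingMemory C₉ ω`).  The η-rate of the tower and the fading of the history moduli are the SAME scalar condition — row
C24's hypothesis carries clause N2, it does not remove it from the programme. [folklore] -/
theorem towerRate_iff_lt_one {γ C ℓ b : ℝ} (ha0 : 0 ≤ a)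
    (hφb : ∀ x, 0 < x → x ≤ γ → |φ x| ≤ C) (hφl : ∀ x y, |φ x - φ y| ≤ ℓ * |x - y|) (hℓ : 0 < ℓ)
    (hb0 : 0 < b) (hbγ : b ≤ γ) (hb : φ b ≠ 0) :
    ((∃ C₅ θ : ℝ, 0 ≤ θ ∧ θ < 1 ∧ ∀ m, ∀ g ∈ Window γ,
        |linTower a φ (m + 1) g - linTower a φ m (fun i => g (i + 1))| ≤ C₅ * θ ^ m) ↔ a < 1) ∧
    (a < 1 ↔ ∃ C₉ ω : ℝ, 0 ≤ ω ∧ ω < 1 ∧ FadingMemory C₉ ω (fun m i => ℓ * |a| ^ (m - 1 - i))) := by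
  have hbW : (fun _ : ℕ => b) ∈ Window γ := fun _ => ⟨hb0, hbγ⟩
  have _ := hφl  -- the Lipschitz bound enters only through the shape of the natural moduli (`moduli_linTower`)
  refine ⟨⟨fun h => ?_, fun ha1 => ?_⟩, ⟨fun ha1 => ?_, fun h => ?_⟩⟩
  · by_contra hge
    exact not_towerRate_of_one_le (not_lt.mp hge) hb hbW h
  · exact ⟨C, a, ha0, ha1, fun m g hg => towerRate_of_lt_one ha0 (S := Set.Ioc 0 γ) (fun x hx => hφb x hx.1 hx.2) m (hg 0)⟩
  · rcases ha0.eq_or_lt with h0 | hpos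
    · -- a = 0: the moduli vanish off the last coupling; FadingMemory ℓ (1/2)
      refine ⟨ℓ * 2, 1 / 2, by norm_num, by norm_num, fun k i _ => ?_⟩
      show 0 ≤ ℓ * |a| ^ (k - 1 - i) ∧ ℓ * |a| ^ (k - 1 - i) ≤ ℓ * 2 * (1 / 2) ^ (k - i)
      rw [← h0, abs_zero]
      refine ⟨by positivity, ?_⟩
      rcases Nat.eq_zero_or_pos (k - 1 - i) with hk | hk
      · have hki : k - i ≤ 1 := by omega
        rw [hk, pow_zero, mul_one]
        have hp : (1 / 2 : ℝ) ^ 1 ≤ (1 / 2) ^ (k - i) := pow_le_pow_of_le_one (by norm_num) (by norm_num) hki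
        nlinarith
      · rw [zero_pow hk.ne', mul_zero]
        positivity
    · exact ⟨ℓ / a, a, ha0, ha1, fadingMemory_moduli_of_lt_one hpos ha1 hℓ.le⟩
  · obtain ⟨C₉, ω, hω0, hω1, hF⟩ := h
    by_contra hge
    exact not_fadingMemory_moduli_of_one_le (not_lt.mp hge) hℓ hω0 hω1 hF

end Summit.QuantumFields.BalabanUV.T4Continuum.NE9.TowerRateRelocation
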